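import Summits.QuantumAdvantage.QuantumAdvantage.Theorems.LinnikCubicClassGroupsDegreeOnePrimesEscapeComposition
import HarnessLib

/-!
# Crux `DegreeOnePrimesEscape` (stmt-QuantumAdvantage-11543) — the composition with a DEGREE-LOCAL upper shadow

Line `dedekind-s3-collision`.  The registered stub `stub_shadowsComposition` (`…Composition.lean`) takes the
upper shadow with ONE constant `C₀` for all degrees (`∃ C₀, ∀ K, 1 < [K:ℚ] → …`), which is what the uniform
additive class PNT gives.  From the DEGREE-LOCAL additive class PNT (the form the tree proves,
`classPNTAdditive_allFields`) one gets the upper shadow degree by degree (`upperShadow_of_additive_local`,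
`∀ n > 1, ∃ C₀(n), ∀ K of degree n, …`); since the crux is itself degree-local (`∀ n, ∃ C(n), …`), the same
counting composition goes through with `C₀(n)` — this file is that composition, verbatim the registered
stub's proof with the first `obtain` moved under `intro n` (the counting helpers `Dock.size_ineq`,
`Dock.pow_bound` are imported from `…Composition.lean`).  Cell B2b-1 (linnik-cubic), PART B; value = theorem,
NOT summit progress.
-/

noncomputable section

open scoped NumberField nonZeroDivisors
open Literature.NumberTheory.LFunctions Literature.NumberTheory.LFunctions.NumberField

namespace Summit.QuantumAdvantage.QuantumAdvantage.Theorems.DegreeOnePrimesEscape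

/-- **The composition with a degree-local upper shadow** (pure counting; conclusion = the crux
`LinnikCubicClassGroups.DegreeOnePrimesEscape` unfolded verbatim): outside `M` = (degree-one primes) − (degree-one
primes in `M`) ≥ (29/32)Li − n·π(√x) − (33/64)Li since `[Cl:M] ≥ 2`, and `π(x) ≤ 8 · outside` for `x ≥ Q^C`
(the registered stub's proof with `C₀ = C₀(n)`). -/
theorem shadowsComposition_local :
    (∀ n : ℕ, 1 < n → ∃ C₀ : ℝ, ∀ (K : Type) [Field K] [NumberField K], Module.finrank ℚ K = n →
      ∀ x : ℝ, ThornerZaman.condQn K ^ C₀ ≤ x →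
      ∀ M : Subgroup (ClassGroup (𝓞 K)),
        32 * (M.index : ℝ) *
            (Set.ncard {P : Ideal (𝓞 K) | P.IsPrime ∧ (Ideal.absNorm P : ℝ) ≤ x ∧
                ∃ hP : P ∈ (Ideal (𝓞 K))⁰, ClassGroup.mk0 ⟨P, hP⟩ ∈ M} : ℝ)
          ≤ 33 * offsetLogIntegral x) →
    (∀ n : ℕ, 1 < n → ∃ C₁ : ℝ, ∀ (K : Type) [Field K] [NumberField K], Module.finrank ℚ K = n →
      (∀ F : IntermediateField ℚ K, Module.finrank ℚ F ≠ 2) →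
      ∀ x : ℝ, ThornerZaman.condQn K ^ C₁ ≤ x →
        29 * offsetLogIntegral x ≤ 32 * (primeIdealCount K x : ℝ)) →
    (∀ n : ℕ, ∃ C : ℕ, ∀ (K : Type) [Field K] [NumberField K], Module.finrank ℚ K = n →
      (∀ F : IntermediateField ℚ K, Module.finrank ℚ F ≠ 2) → ∀ x : ℕ, |NumberField.discr K| ^ C ≤ (x : ℤ) →
      ∀ M : Subgroup (ClassGroup (NumberField.RingOfIntegers K)), M ≠ ⊤ →
        Nat.primeCounting x ≤ 8 * Set.ncard {P : Ideal (NumberField.RingOfIntegers K) | P.IsPrime ∧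
          (Ideal.absNorm P).Prime ∧ Ideal.absNorm P ≤ x ∧
          ∃ hP : P ∈ nonZeroDivisors (Ideal (NumberField.RingOfIntegers K)), ClassGroup.mk0 ⟨P, hP⟩ ∉ M}) := by
  intro hup hlow
  classical
  intro n
  rcases Nat.lt_or_ge n 3 with hn3 | hn3
  · -- degenerate degrees n ≤ 2: the hypotheses are contradictory
    refine ⟨0, ?_⟩
    intro K _ _ hKn hnq x hx M hM
    exfalso
    interval_cases n
    · exact (Module.finrank_pos (R := ℚ) (M := K)).ne' hKn
    · -- degree one: `𝓞 K ≃ ℤ`, the class group is trivial, so `M = ⊤`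
      apply hM
      have hbij : Function.Bijective (algebraMap ℚ K) :=
        Algebra.finrank_eq_one_iff_bijective_algebraMap.mp hKn
      have : IsIntegralClosure ℤ ℤ K :=
        .of_algEquiv _ (.ofBijective (IsScalarTower.toAlgHom ℤ ℚ K) hbij) (by simp)
      have e : ℤ ≃ₐ[ℤ] 𝓞 K := IsIntegralClosure.equiv ℤ ℤ K (𝓞 K)
      have hPID : IsPrincipalIdealRing (𝓞 K) :=
        IsPrincipalIdealRing.of_surjective (e : ℤ →+* 𝓞 K) e.surjective
      have h1 : NumberField.classNumber K = 1 := (NumberField.classNumber_eq_one_iff).mpr hPID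
      have hsub : Subsingleton (ClassGroup (𝓞 K)) := by
        rw [NumberField.classNumber] at h1
        exact Fintype.card_le_one_iff_subsingleton.mp h1.le
      rw [Subgroup.eq_top_iff']
      intro g
      rw [Subsingleton.elim g 1]
      exact M.one_mem
    · -- degree two: `K` itself is a quadratic subfield
      exact hnq ⊤ (by rw [IntermediateField.finrank_top', hKn])
  · -- the main case n ≥ 3
    have h1n : 1 < n := by omega
    obtain ⟨C₀, hC₀⟩ := hup n h1n
    obtain ⟨C₁, hC₁⟩ := hlow n h1n
    set C' : ℝ := max (max C₀ C₁) 1 with hC'def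
    refine ⟨(⌈C'⌉₊ + 50) * (1 + n ^ 2) + n, ?_⟩
    intro K _ _ hKn hnq x hx M hM
    have hK : 1 < Module.finrank ℚ K := by rw [hKn]; exact h1n
    set Cn : ℕ := (⌈C'⌉₊ + 50) * (1 + n ^ 2) + n with hCndef
    set xr : ℝ := (x : ℝ) with hxrdef
    set d : ℝ := |(NumberField.discr K : ℝ)| with hddef
    set Q : ℝ := ThornerZaman.condQn K with hQdef
    -- d ≥ 3, Q = d n^n ≤ d^(1+n²)
    have hd3 : (3:ℝ) ≤ d := by
      have h2 := NumberField.abs_discr_gt_two hK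
      rw [hddef, ← Int.cast_abs]
      exact_mod_cast (show (3:ℤ) ≤ |NumberField.discr K| by omega)
    have hd1 : (1:ℝ) ≤ d := by linarith
    have hQ : Q = d * (n : ℝ) ^ n := by rw [hQdef, ThornerZaman.condQn, hKn]
    have hnn : (n : ℝ) ^ n ≤ d ^ (n ^ 2) := by
      have h1 : (n : ℝ) ≤ 3 ^ n := by
        exact_mod_cast (Nat.lt_pow_self (by norm_num : 1 < 3) (n := n)).le
      calc (n:ℝ) ^ n ≤ (3 ^ n) ^ n := pow_le_pow_left₀ (by positivity) h1 n
        _ = 3 ^ (n ^ 2) := by rw [← pow_mul]; ring_nf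
        _ ≤ d ^ (n ^ 2) := pow_le_pow_left₀ (by norm_num) hd3 _
    have hQle : Q ≤ d ^ (1 + n ^ 2) := by
      rw [hQ, pow_add, pow_one]
      exact mul_le_mul_of_nonneg_left hnn (by linarith)
    have hQ12 : 12 ≤ Q := ThornerZaman.twelve_le_condQn (K := K) hK
    have hQ1 : 1 ≤ Q := by linarith
    -- x ≥ d^Cn ≥ 3^Cn
    have hx_d : d ^ Cn ≤ xr := by
      have h1 : ((|NumberField.discr K| ^ Cn : ℤ) : ℝ) ≤ ((x : ℤ) : ℝ) := by exact_mod_cast hx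
      rw [Int.cast_pow, Int.cast_abs, Int.cast_natCast] at h1
      exact h1
    have hx_3 : (3:ℝ) ^ Cn ≤ xr := le_trans (pow_le_pow_left₀ (by norm_num) hd3 Cn) hx_d
    -- Q^{C'} ≤ xr
    have hQC' : Q ^ C' ≤ xr := by
      have h1 : Q ^ C' ≤ Q ^ ((⌈C'⌉₊ + 50 : ℕ) : ℝ) := by
        apply Real.rpow_le_rpow_of_exponent_le hQ1
        have := Nat.le_ceil C'
        push_cast
        linarith
      rw [Real.rpow_natCast] at h1
      calc Q ^ C' ≤ Q ^ (⌈C'⌉₊ + 50) := h1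
        _ ≤ (d ^ (1 + n ^ 2)) ^ (⌈C'⌉₊ + 50) := pow_le_pow_left₀ (by linarith) hQle _
        _ = d ^ ((1 + n ^ 2) * (⌈C'⌉₊ + 50)) := by rw [← pow_mul]
        _ ≤ d ^ Cn := pow_le_pow_right₀ hd1 (by rw [hCndef]; nlinarith)
        _ ≤ xr := hx_d
    have hC₀le : C₀ ≤ C' := le_trans (le_max_left _ _) (le_max_left _ _)
    have hC₁le : C₁ ≤ C' := le_trans (le_max_right _ _) (le_max_left _ _)
    have hQC₀ : Q ^ C₀ ≤ xr := le_trans (Real.rpow_le_rpow_of_exponent_le hQ1 hC₀le) hQC'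
    have hQC₁ : Q ^ C₁ ≤ xr := le_trans (Real.rpow_le_rpow_of_exponent_le hQ1 hC₁le) hQC'
    have hupK := hC₀ K hKn xr hQC₀ M
    have hlowK := hC₁ K hKn hnq xr hQC₁
    -- sizes
    have hCn50 : 50 * (1 + n ^ 2) ≤ Cn := by rw [hCndef]; nlinarith
    have hxbig : (100 * ((n:ℝ) + 1)) ^ 4 ≤ xr := by
      have h1 : ((100 * (n + 1)) ^ 4 : ℕ) ≤ 3 ^ Cn := Dock.pow_bound n Cn hCn50
      have h2 : (((100 * (n + 1)) ^ 4 : ℕ) : ℝ) ≤ ((3 ^ Cn : ℕ) : ℝ) := by exact_mod_cast h1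
      push_cast at h2
      linarith
    have hsize := Dock.size_ineq n hxbig
    have hx3' : (3:ℝ) ≤ xr := by
      have : (3:ℝ) ^ 1 ≤ 3 ^ Cn := pow_le_pow_right₀ (by norm_num) (by omega)
      linarith
    have hxpos : 0 < xr := by linarith
    have hx1 : 1 < xr := by linarith
    have hx2 : 2 ≤ xr := by linarith
    have hlogx : 1 ≤ Real.log xr := by
      rw [Real.le_log_iff_exp_le hxpos]
      have := Real.exp_one_lt_d9
      linarith
    have hlogpos : 0 < Real.log xr := by linarith
    -- Li ≥ (x-2)/log x ≥ x/log x − 2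
    have hLi : xr / Real.log xr - 2 ≤ offsetLogIntegral xr := by
      have h1 := sub_mul_inv_log_pow_le_offsetLogIntegralPow 1 hx2
      rw [offsetLogIntegralPow_one, pow_one, ← div_eq_mul_inv] at h1
      have h2 : xr / Real.log xr - 2 ≤ (xr - 2) / Real.log xr := by
        rw [sub_div]
        have : 2 / Real.log xr ≤ 2 := by
          rw [div_le_iff₀ hlogpos]; nlinarith
        linarith
      linarith
    -- π(x) ≤ 2 log 4 · x/log x + √x
    have hA0 : 0 ≤ xr / Real.log xr := by positivity
    have hpi : (Nat.primeCounting x : ℝ) ≤ 2.7726 * (xr / Real.log xr) + Real.sqrt xr := by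
      have h1 := Chebyshev.pi_le_log4_mul_div hx1
      rw [hxrdef, Nat.floor_natCast] at h1
      have hlogsqrt : Real.log (Real.sqrt (x:ℝ)) = Real.log (x:ℝ) / 2 := Real.log_sqrt (by positivity)
      rw [hlogsqrt] at h1
      have e3 : Real.log 4 * (x:ℝ) / (Real.log (x:ℝ) / 2) = 2 * Real.log 4 * ((x:ℝ) / Real.log (x:ℝ)) := by
        field_simp
      rw [e3] at h1
      have hlog4 : Real.log 4 < 1.3863 := by
        have : Real.log 4 = 2 * Real.log 2 := by
          rw [show (4:ℝ) = 2 ^ 2 by norm_num, Real.log_pow]; norm_num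
        rw [this]; have := Real.log_two_lt_d9; linarith
      have h4 : 2 * Real.log 4 * (xr / Real.log xr) ≤ 2.7726 * (xr / Real.log xr) :=
        mul_le_mul_of_nonneg_right (by linarith) hA0
      rw [hxrdef] at h4 ⊢
      linarith
    -- counting
    set Sout : Set (Ideal (𝓞 K)) := {P : Ideal (𝓞 K) | P.IsPrime ∧ (Ideal.absNorm P).Prime ∧
        Ideal.absNorm P ≤ x ∧ ∃ hP : P ∈ nonZeroDivisors (Ideal (𝓞 K)), ClassGroup.mk0 ⟨P, hP⟩ ∉ M}
      with hSout
    set Sin : Set (Ideal (𝓞 K)) := {P : Ideal (𝓞 K) | P.IsPrime ∧ (Ideal.absNorm P : ℝ) ≤ xr ∧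
        ∃ hP : P ∈ (Ideal (𝓞 K))⁰, ClassGroup.mk0 ⟨P, hP⟩ ∈ M} with hSin
    set D : Set (Ideal (𝓞 K)) := {P : Ideal (𝓞 K) | P.IsPrime ∧ P ≠ ⊥ ∧ (Ideal.absNorm P).Prime ∧
        Ideal.absNorm P ≤ x} with hD
    have hfin : (Sout ∪ Sin).Finite := by
      refine (Ideal.finite_setOf_absNorm_le (S := 𝓞 K) x).subset ?_
      rintro P (⟨-, -, h3, -⟩ | ⟨-, h2, -⟩)
      · exact h3
      · show Ideal.absNorm P ≤ x
        have h2' : (Ideal.absNorm P : ℝ) ≤ (x : ℝ) := h2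
        exact_mod_cast h2'
    have hcover : D ⊆ Sout ∪ Sin := by
      rintro P ⟨h1, h2, h3, h4⟩
      have hP : P ∈ (Ideal (𝓞 K))⁰ := mem_nonZeroDivisors_of_ne_zero h2
      by_cases hc : ClassGroup.mk0 ⟨P, hP⟩ ∈ M
      · right
        refine ⟨h1, ?_, hP, hc⟩
        show (Ideal.absNorm P : ℝ) ≤ (x : ℝ)
        exact_mod_cast h4
      · left; exact ⟨h1, h3, h4, hP, hc⟩
    have hcount : Set.ncard D ≤ Set.ncard Sout + Set.ncard Sin :=
      le_trans (Set.ncard_le_ncard hcover hfin) (Set.ncard_union_le _ _)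
    have hDeq : Set.ncard D = ∑ p ∈ (Finset.Icc 0 x).filter Nat.Prime, normPrimeIdealCount K p :=
      ncard_degOne_eq_sum K x
    have hdeg := primeIdealCount_le_degOne_add K x
    rw [hKn, ← hDeq] at hdeg
    -- π(√x) ≤ √x + 1
    have hpisqrt : (Nat.primeCounting (Nat.sqrt x) : ℝ) ≤ Real.sqrt xr + 1 := by
      have h1 : Nat.primeCounting (Nat.sqrt x) ≤ Nat.sqrt x + 1 := by
        rw [Nat.primeCounting, Nat.primeCounting']
        exact Nat.count_le _
      have h2 : ((Nat.sqrt x : ℕ) : ℝ) ≤ Real.sqrt xr := by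
        rw [hxrdef, Real.le_sqrt (by positivity) (by positivity)]
        exact_mod_cast Nat.sqrt_le' x
      calc (Nat.primeCounting (Nat.sqrt x) : ℝ) ≤ (Nat.sqrt x : ℝ) + 1 := by exact_mod_cast h1
        _ ≤ Real.sqrt xr + 1 := by linarith
    -- index ≥ 2
    have hidx : (2 : ℝ) ≤ M.index := by
      have h1 : M.index ≠ 1 := fun h => hM (Subgroup.index_eq_one.mp h)
      have h2 : M.index ≠ 0 := Subgroup.index_ne_zero_of_finite
      exact_mod_cast (show 2 ≤ M.index by omega)
    have hin0 : (0:ℝ) ≤ Set.ncard Sin := Nat.cast_nonneg _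
    have hup' : 64 * (Set.ncard Sin : ℝ) ≤ 33 * offsetLogIntegral xr := by
      have : 32 * 2 * (Set.ncard Sin : ℝ) ≤ 32 * (M.index : ℝ) * (Set.ncard Sin : ℝ) := by
        apply mul_le_mul_of_nonneg_right _ hin0
        linarith
      linarith
    -- assembly in ℝ
    have e1 : ((primeIdealCount K xr : ℕ) : ℝ) ≤
        (Set.ncard D : ℝ) + (n : ℝ) * Real.sqrt xr + n := by
      have h1 : ((primeIdealCount K (x:ℝ) : ℕ) : ℝ) ≤
          ((Set.ncard D + n * Nat.primeCounting (Nat.sqrt x) : ℕ) : ℝ) := by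
        exact_mod_cast hdeg
      push_cast at h1
      have hn0 : (0:ℝ) ≤ n := Nat.cast_nonneg n
      have h2 : (n:ℝ) * (Nat.primeCounting (Nat.sqrt x) : ℝ) ≤ n * (Real.sqrt xr + 1) :=
        mul_le_mul_of_nonneg_left hpisqrt hn0
      have h3 : (n:ℝ) * (Real.sqrt xr + 1) = n * Real.sqrt xr + n := by ring
      rw [h3] at h2
      rw [hxrdef] at h2 ⊢
      linarith
    have e2 : (Set.ncard D : ℝ) ≤ Set.ncard Sout + Set.ncard Sin := by exact_mod_cast hcount
    have hsqrt0 : 0 ≤ Real.sqrt xr := Real.sqrt_nonneg _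
    have hgoal : (Nat.primeCounting x : ℝ) ≤ 8 * (Set.ncard Sout : ℝ) := by
      linarith [hlowK, hup', e1, e2, hLi, hpi, hsize, hsqrt0]
    exact_mod_cast hgoal

end Summit.QuantumAdvantage.QuantumAdvantage.Theorems.DegreeOnePrimesEscape

end
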